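import Literature.MathematicalPhysics.QuantumLattice.HubbardVertexWick
import Literature.MathematicalPhysics.QuantumLattice.HubbardVertexCoefficientLimit
import Literature.MathematicalPhysics.QuantumLattice.HubbardEffectiveAction
import Literature.MathematicalPhysics.QuantumLattice.HubbardDysonDeterminant
import Literature.MathematicalPhysics.QuantumLattice.HubbardSpaceTimeCharacters
import Mathlib.MeasureTheory.Integral.Pi
import Mathlib.Analysis.SpecialFunctions.Integrals.Basic
import HarnessLib

/-!
# The moments of the Hubbard interaction: momentum conservation versus the space–time integral of vertices

Topic `MathematicalPhysics/QuantumLattice`; the bookkeeping step of the `M → ∞` ("Matsubara UV") bridge between the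
finite-frequency Grassmann representation of the Hubbard torus (`HubbardEffectiveAction.hubbardInteraction`, the
interaction `V = U (βL²)⁻³ Σ_{k₁+k₃=k₂+k₄} ψ̂⁺_{k₁↑}ψ̂⁻_{k₂↑}ψ̂⁺_{k₃↓}ψ̂⁻_{k₄↓}` in MOMENTUM space, BGM 2006 (2.6a)
after (2.5)) and its POSITION–time form `V = U Σ_{x⃗} ∫₀^β dτ ψ⁺_{x↑}ψ⁻_{x↑}ψ⁺_{x↓}ψ⁻_{x↓}` whose vertex fields are
realised by the substitution matrix `vertexSubMatrix` (`HubbardVertexFieldSubstitution`).  Since the finite Grassmann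
algebra carries no integration of algebra-valued functions, the identity is stated after an arbitrary linear
functional `φ` (in particular a Gaussian expectation `gaussExpect C`), for all powers at once:

* `prod_ofFn_sum_smul` — ordered products of finite linear combinations expand multilinearly;
* `vertexMonomial κ = ψ̂⁺_{κ₀↑}ψ̂⁻_{κ₁↑}ψ̂⁺_{κ₂↓}ψ̂⁻_{κ₃↓}`, `vertexConserving κ` (the conservation constraint of
  `hubbardInteraction`), `vertexFreqTransfer κ = n₀−n₁+n₂−n₃ ∈ ℤ`, `vertexMomTransfer κ = k⃗₀−k⃗₁+k⃗₂−k⃗₃`;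
  `hubbardInteraction_eq_sum_smul` — `V = Σ_κ [cons κ]·U(βL²)⁻³ • vertexMonomial κ`;
* `vertexFieldWord β x τ a = ψ⁺_{a↑}ψ⁻_{a↑}ψ⁺_{a↓}ψ⁻_{a↓}` — the four position–time fields of vertex `a` at
  `(x⃗_a, τ_a)` (images of the leg generators under `map (toLin' S)`); **`vertexFieldWord_eq_sum`** — its momentum
  expansion `(βL²)⁻⁴ Σ_κ e^{2πi m(κ) τ_a/β} χ_{q(κ)}(x⃗_a) • vertexMonomial κ` (`m`, `q` the transfers: the four leg
  phases combine to ONE character of the space–time torus, `vertexLegPhases_eq`);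
* orthogonality: `integral_Icc_exp_freqTransfer` (`∫₀^β e^{2πimτ/β}dτ = β[m=0]`), `sum_torusChar_right`
  (`Σ_x⃗ χ_q(x⃗) = L²[q=0]`), so `Σ_{x⃗}∫₀^β` of the vertex phase is `βL²·[cons κ]` (`sum_integral_vertexLegPhases`,
  `vertexConserving_iff`);
* **`linearMap_apply_hubbardInteraction_pow`** — for every linear `φ : HubbardGrassmann L M → ℂ`, `β > 0`, `n`:
  `φ(Vⁿ) = Uⁿ Σ_{x⃗ ∈ Λⁿ} ∫_{[0,β]ⁿ} φ(Π_a vertexFieldWord β x τ a) dτ` (BGM 2006, (2.6a) ⇔ (2.6) at every finite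
  frequency cutoff; `integral_fintype_prod_eq_prod` and `Fintype.prod_sum` factorise the space–time integral);
* `prod_vertexFieldWord_eq_map_genPairProd` — the vertex word is the image of the paired monomial with the standard
  pair enumeration `finProdFinEquiv.symm : Fin (n·2) → Fin n × Fin 2`, hence with `HubbardVertexWick`:
  **`gaussExpect_hubbardInteraction_pow_eq_det`** —
  `∫dμ_{C_M} Vⁿ = Uⁿ Σ_{x⃗} ∫_{[0,β]ⁿ} det[−(SᵀC_MS)((aσ,+),(bσ',−))] dτ` (BGM 2006, (2.6)–(2.8) at cutoff `M`), and with
  `HubbardVertexCoefficientLimit`: **`tendsto_gaussExpect_hubbardInteraction_pow`** — as `M → ∞` the `n`-th moment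
  converges to `Uⁿ Σ_{x⃗} ∫_{[0,β]ⁿ} det[vertexLimitEntry] dτ` (free imaginary-time propagators, midpoint at equal times).

The sum over `n` (the truncated exponential series, uniform domination) and the identification with the Hamiltonian
determinant series `ShiftedHubbardDysonDeterminant` (`ν = ½`) are NOT here.

## Sources

G. Benfatto, A. Giuliani, V. Mastropietro, Ann. Henri Poincaré 7 (2006) 809–898 = arXiv:cond-mat/0507686, §2.1
(2.5)–(2.8) [`BenfattoGiulianiMastropietro2006`]; M. Salmhofer, *Renormalization* (1999), §4.2.4 (4.55)–(4.63),
App. B.2 [`Salmhofer1999`].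
-/

noncomputable section

namespace Literature.MathematicalPhysics.QuantumLattice

open GrassmannAlgebra Finset Filter _root_.MeasureTheory Literature.Probability.LatticeModels _root_.Topology
open scoped ComplexConjugate

/-! ### Generic algebra: expanding ordered products of linear combinations -/

section Generic

variable {R A ι : Type*} [CommSemiring R] [Semiring A] [Algebra R A] [Fintype ι]

/-- **Ordered products of finite linear combinations expand multilinearly**:
`Π_a (Σ_i c_a(i) • m_a(i)) = Σ_K (Π_a c_a(K a)) • Π_a m_a(K a)` (ordered `List` products, `K` over all choice
functions). [folklore] -/
theorem prod_ofFn_sum_smul {n : ℕ} (c : Fin n → ι → R) (m : Fin n → ι → A) :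
    (List.ofFn fun a => ∑ i, c a i • m a i).prod =
      ∑ K : Fin n → ι, (∏ a, c a (K a)) • (List.ofFn fun a => m a (K a)).prod := by
  induction n with
  | zero => simp
  | succ n ih =>
    rw [List.ofFn_succ, List.prod_cons, ih (fun a => c a.succ) (fun a => m a.succ), Finset.sum_mul,
      ← (Fin.consEquiv fun _ => ι).sum_comp, Fintype.sum_prod_type]
    refine Finset.sum_congr rfl fun i _ => ?_
    rw [Finset.mul_sum]
    refine Finset.sum_congr rfl fun K _ => ?_
    rw [smul_mul_smul_comm]
    simp only [Fin.consEquiv, Equiv.coe_fn_mk, Fin.prod_univ_succ, Fin.cons_zero, Fin.cons_succ, List.ofFn_succ,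
      List.prod_cons]

/-- Sums over `Fin 4 → α` are fourfold sums. [folklore] -/
theorem sum_pi_fin_four {α β : Type*} [Fintype α] [AddCommMonoid β] (f : (Fin 4 → α) → β) :
    ∑ κ : Fin 4 → α, f κ = ∑ a, ∑ b, ∑ c, ∑ d, f ![a, b, c, d] := by
  rw [← (Fin.consEquiv fun _ => α).sum_comp, Fintype.sum_prod_type]
  refine sum_congr rfl fun a _ => ?_
  rw [← (Fin.consEquiv fun _ => α).sum_comp, Fintype.sum_prod_type]
  refine sum_congr rfl fun b _ => ?_
  rw [← (Fin.consEquiv fun _ => α).sum_comp, Fintype.sum_prod_type]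
  refine sum_congr rfl fun c _ => ?_
  rw [← (Fin.consEquiv fun _ => α).sum_comp, Fintype.sum_prod_type]
  refine sum_congr rfl fun d _ => ?_
  rw [Fintype.sum_unique]
  congr 1

/-- `![a,b,c,d] 0 = a`. [folklore] -/
theorem vecCons_four_apply_zero {α : Type*} (a b c d : α) : ![a, b, c, d] 0 = a := rfl

/-- `![a,b,c,d] 1 = b`. [folklore] -/
theorem vecCons_four_apply_one {α : Type*} (a b c d : α) : ![a, b, c, d] 1 = b := rfl

/-- `![a,b,c,d] 2 = c`. [folklore] -/
theorem vecCons_four_apply_two {α : Type*} (a b c d : α) : ![a, b, c, d] 2 = c := rfl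

/-- `![a,b,c,d] 3 = d`. [folklore] -/
theorem vecCons_four_apply_three {α : Type*} (a b c d : α) : ![a, b, c, d] 3 = d := rfl

/-- A product of four finite linear combinations, expanded over `Fin 4 → ι`. [folklore] -/
theorem sum_smul_mul_four (c₀ c₁ c₂ c₃ : ι → R) (m₀ m₁ m₂ m₃ : ι → A) :
    (∑ i, c₀ i • m₀ i) * (∑ i, c₁ i • m₁ i) * (∑ i, c₂ i • m₂ i) * (∑ i, c₃ i • m₃ i) =
      ∑ κ : Fin 4 → ι, (c₀ (κ 0) * c₁ (κ 1) * c₂ (κ 2) * c₃ (κ 3)) •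
        (m₀ (κ 0) * m₁ (κ 1) * m₂ (κ 2) * m₃ (κ 3)) := by
  have h := prod_ofFn_sum_smul (n := 4) (fun j => ![c₀, c₁, c₂, c₃] j) (fun j => ![m₀, m₁, m₂, m₃] j)
  have h3 : ((2 : Fin 3).succ : Fin 4) = 3 := rfl
  simp only [List.ofFn_succ, List.ofFn_zero, List.prod_cons, List.prod_nil, mul_one, Fin.prod_univ_four,
    Matrix.cons_val_succ, Matrix.cons_val_zero, vecCons_four_apply_one, vecCons_four_apply_two,
    vecCons_four_apply_three, Fin.succ_zero_eq_one, Fin.succ_one_eq_two, h3] at h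
  simpa only [mul_assoc] using h

end Generic

/-! ### The vertex in momentum space -/

section Momentum

variable (L M : ℕ)

/-- The **momentum monomial of one vertex** with leg labels `κ : Fin 4 → (ω, k⃗)`:
`ψ̂⁺_{κ₀↑} ψ̂⁻_{κ₁↑} ψ̂⁺_{κ₂↓} ψ̂⁻_{κ₃↓}` (the summand of `hubbardInteraction`).
[cite: BenfattoGiulianiMastropietro2006, §2.1 (2.6a)] -/
def vertexMonomial (κ : Fin 4 → FreqMomentum L M) : HubbardGrassmann L M :=
  psiPlus (κ 0) 0 * psiMinus (κ 1) 0 * psiPlus (κ 2) 1 * psiMinus (κ 3) 1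

/-- The **conservation constraint** of `hubbardInteraction`: integer frequency labels `n₀ + n₂ = n₁ + n₃` and torus
momenta `k⃗₀ + k⃗₂ = k⃗₁ + k⃗₃`. [cite: BenfattoGiulianiMastropietro2006, §2.1 (2.6a)] -/
def vertexConserving (κ : Fin 4 → FreqMomentum L M) : Prop :=
  matsubaraInt M (κ 0).1 + matsubaraInt M (κ 2).1 = matsubaraInt M (κ 1).1 + matsubaraInt M (κ 3).1 ∧
    (κ 0).2 + (κ 2).2 = (κ 1).2 + (κ 3).2

/-- The conservation constraint is decidable (integer and `ℤ/Lℤ` equalities). [folklore] -/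
instance (κ : Fin 4 → FreqMomentum L M) : Decidable (vertexConserving L M κ) :=
  inferInstanceAs (Decidable (_ ∧ _))

/-- The **frequency transfer** of a vertex, the integer `m = n₀ − n₁ + n₂ − n₃`
(`ω₀ − ω₁ + ω₂ − ω₃ = 2πm/β`). [folklore] -/
def vertexFreqTransfer (κ : Fin 4 → FreqMomentum L M) : ℤ :=
  matsubaraInt M (κ 0).1 - matsubaraInt M (κ 1).1 + matsubaraInt M (κ 2).1 - matsubaraInt M (κ 3).1

/-- The **momentum transfer** of a vertex, `q = k⃗₀ − k⃗₁ + k⃗₂ − k⃗₃ ∈ (ℤ/Lℤ)²`. [folklore] -/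
def vertexMomTransfer (κ : Fin 4 → FreqMomentum L M) : TorusSite 2 L :=
  (κ 0).2 - (κ 1).2 + (κ 2).2 - (κ 3).2

variable {L M}

/-- Conservation means vanishing transfers. [folklore] -/
theorem vertexConserving_iff (κ : Fin 4 → FreqMomentum L M) :
    vertexConserving L M κ ↔ vertexFreqTransfer L M κ = 0 ∧ vertexMomTransfer L M κ = 0 := by
  unfold vertexConserving vertexFreqTransfer vertexMomTransfer
  refine and_congr ⟨fun h => by linarith, fun h => by linarith⟩ ⟨fun h => ?_, fun h => ?_⟩
  · rw [show (κ 0).2 - (κ 1).2 + (κ 2).2 - (κ 3).2 = ((κ 0).2 + (κ 2).2) - ((κ 1).2 + (κ 3).2) by abel, h, sub_self]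
  · have h' : ((κ 0).2 + (κ 2).2) - ((κ 1).2 + (κ 3).2) = 0 := by
      rw [← h]; abel
    exact sub_eq_zero.1 h'

variable (L M) in
/-- **The interaction as a linear combination of vertex monomials**:
`V = Σ_κ [cons κ]·U(βL²)⁻³ • ψ̂⁺_{κ₀↑}ψ̂⁻_{κ₁↑}ψ̂⁺_{κ₂↓}ψ̂⁻_{κ₃↓}`. [cite: BenfattoGiulianiMastropietro2006, §2.1 (2.6a)] -/
theorem hubbardInteraction_eq_sum_smul [NeZero L] (β U : ℝ) :
    hubbardInteraction L M β U = ∑ κ : Fin 4 → FreqMomentum L M,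
      (if vertexConserving L M κ then ((U / (β * (L : ℝ) ^ 2) ^ 3 : ℝ) : ℂ) else 0) • vertexMonomial L M κ := by
  rw [hubbardInteraction, sum_pi_fin_four]
  simp only [Finset.smul_sum]
  refine sum_congr rfl fun a _ => sum_congr rfl fun b _ => sum_congr rfl fun c _ => sum_congr rfl fun d _ => ?_
  rw [smul_ite, smul_zero, ite_smul, zero_smul]
  simp only [vertexConserving, vertexMonomial, vecCons_four_apply_zero, vecCons_four_apply_one,
    vecCons_four_apply_two, vecCons_four_apply_three]

end Momentum

/-! ### The vertex in position space: the field word and its momentum expansion -/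

section Position

variable (L M : ℕ) [NeZero L]

/-- The **position–time field word of vertex `a`** at `(x⃗_a, τ_a)`:
`ψ⁺_{(x_a,τ_a)↑} ψ⁻_{(x_a,τ_a)↑} ψ⁺_{(x_a,τ_a)↓} ψ⁻_{(x_a,τ_a)↓}`, the four leg generators pushed through the
vertex-field substitution `S = vertexSubMatrix β x τ` (BGM 2006, (2.5)–(2.6a)).
[cite: BenfattoGiulianiMastropietro2006, §2.1 (2.6a)] -/
def vertexFieldWord (β : ℝ) {n : ℕ} (x : Fin n → TorusSite 2 L) (τ : Fin n → ℝ) (a : Fin n) : HubbardGrassmann L M :=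
  ExteriorAlgebra.map (Matrix.toLin' (vertexSubMatrix L M β x τ)) (gen ℂ (((a, 0), 0) : VertexLeg n)) *
    ExteriorAlgebra.map (Matrix.toLin' (vertexSubMatrix L M β x τ)) (gen ℂ (((a, 0), 1) : VertexLeg n)) *
    ExteriorAlgebra.map (Matrix.toLin' (vertexSubMatrix L M β x τ)) (gen ℂ (((a, 1), 0) : VertexLeg n)) *
    ExteriorAlgebra.map (Matrix.toLin' (vertexSubMatrix L M β x τ)) (gen ℂ (((a, 1), 1) : VertexLeg n))

variable {L M}

/-- The `ψ⁺` leg phase: `conj(e^{-ik·x}) = e^{iωt} χ_{k⃗}(y⃗)`. [cite: BenfattoGiulianiMastropietro2006, §2.1 (2.5)] -/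
theorem conj_vertexPlaneWave_zero_eq (β : ℝ) (k : FreqMomentum L M) (y : TorusSite 2 L) (t : ℝ) :
    conj (vertexPlaneWave L M β 0 k y t) =
      Complex.exp (((matsubaraFreq β M k.1 * t : ℝ) : ℂ) * Complex.I) * torusChar k.2 y := by
  have hsp : Complex.exp (((∑ j, latticeMomentum L k.2 j * (((y j).val : ℝ)) : ℝ) : ℂ) * Complex.I) =
      torusChar k.2 y := by
    have h := exp_latticeMomentum_phase_eq_torusChar k.2 y 0
    simp only [Pi.zero_apply, ZMod.val_zero, Nat.cast_zero, sub_zero] at h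
    exact h
  rw [conj_vertexPlaneWave, vertexPhase, ← hsp, ← Complex.exp_add]
  congr 1
  simp only [chargeSign, if_true, one_mul]
  push_cast
  ring

/-- The `ψ⁻` leg phase: `conj(e^{+ik·x}) = e^{-iωt} conj χ_{k⃗}(y⃗)`. [cite: BenfattoGiulianiMastropietro2006, §2.1 (2.5)] -/
theorem conj_vertexPlaneWave_one_eq (β : ℝ) (k : FreqMomentum L M) (y : TorusSite 2 L) (t : ℝ) :
    conj (vertexPlaneWave L M β 1 k y t) =
      Complex.exp (-(((matsubaraFreq β M k.1 * t : ℝ) : ℂ) * Complex.I)) * conj (torusChar k.2 y) := by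
  have hsp : Complex.exp (((∑ j, latticeMomentum L k.2 j * (((y j).val : ℝ)) : ℝ) : ℂ) * Complex.I) =
      torusChar k.2 y := by
    have h := exp_latticeMomentum_phase_eq_torusChar k.2 y 0
    simp only [Pi.zero_apply, ZMod.val_zero, Nat.cast_zero, sub_zero] at h
    exact h
  rw [conj_vertexPlaneWave, vertexPhase, ← hsp, ← Complex.exp_conj, ← Complex.exp_add]
  congr 1
  simp only [chargeSign, show (1 : Fin 2) ≠ 0 from by decide, if_false, map_mul, Complex.conj_ofReal, Complex.conj_I]
  push_cast
  ring

/-- **The four leg phases of a vertex combine to one space–time character**: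
`conj(e^{-ik₀x})conj(e^{ik₁x})conj(e^{-ik₂x})conj(e^{ik₃x}) = e^{2πi m τ/β} χ_q(x⃗)` with the transfers
`m = n₀−n₁+n₂−n₃`, `q = k⃗₀−k⃗₁+k⃗₂−k⃗₃` (the fermionic half-integer offsets cancel between `ψ⁺` and `ψ⁻` legs).
[cite: BenfattoGiulianiMastropietro2006, §2.1 (2.5)-(2.6a)] -/
theorem vertexLegPhases_eq (β : ℝ) (κ : Fin 4 → FreqMomentum L M) (y : TorusSite 2 L) (t : ℝ) :
    conj (vertexPlaneWave L M β 0 (κ 0) y t) * conj (vertexPlaneWave L M β 1 (κ 1) y t) *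
        conj (vertexPlaneWave L M β 0 (κ 2) y t) * conj (vertexPlaneWave L M β 1 (κ 3) y t) =
      Complex.exp (((2 * Real.pi * (vertexFreqTransfer L M κ) * t / β : ℝ) : ℂ) * Complex.I) *
        torusChar (vertexMomTransfer L M κ) y := by
  rw [conj_vertexPlaneWave_zero_eq, conj_vertexPlaneWave_one_eq, conj_vertexPlaneWave_zero_eq,
    conj_vertexPlaneWave_one_eq, vertexMomTransfer, torusChar_sub_left, torusChar_add_left, torusChar_sub_left]
  have hfreq : Complex.exp (((matsubaraFreq β M (κ 0).1 * t : ℝ) : ℂ) * Complex.I) *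
      Complex.exp (-(((matsubaraFreq β M (κ 1).1 * t : ℝ) : ℂ) * Complex.I)) *
      Complex.exp (((matsubaraFreq β M (κ 2).1 * t : ℝ) : ℂ) * Complex.I) *
      Complex.exp (-(((matsubaraFreq β M (κ 3).1 * t : ℝ) : ℂ) * Complex.I)) =
      Complex.exp (((2 * Real.pi * (vertexFreqTransfer L M κ) * t / β : ℝ) : ℂ) * Complex.I) := by
    rw [← Complex.exp_add, ← Complex.exp_add, ← Complex.exp_add]
    congr 1
    simp only [matsubaraFreq, vertexFreqTransfer]
    push_cast
    ring
  rw [← hfreq]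
  ring

/-- **The momentum expansion of the vertex field word**:
`ψ⁺_{x↑}ψ⁻_{x↑}ψ⁺_{x↓}ψ⁻_{x↓}(x⃗_a,τ_a) = (βL²)⁻⁴ Σ_κ e^{2πi m(κ)τ_a/β} χ_{q(κ)}(x⃗_a) • vertexMonomial κ`.
[cite: BenfattoGiulianiMastropietro2006, §2.1 (2.5)-(2.6a)] -/
theorem vertexFieldWord_eq_sum (β : ℝ) {n : ℕ} (x : Fin n → TorusSite 2 L) (τ : Fin n → ℝ) (a : Fin n) :
    vertexFieldWord L M β x τ a = ∑ κ : Fin 4 → FreqMomentum L M,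
      ((((1 / (β * (L : ℝ) ^ 2)) ^ 4 : ℝ) : ℂ) *
        (Complex.exp (((2 * Real.pi * (vertexFreqTransfer L M κ) * τ a / β : ℝ) : ℂ) * Complex.I) *
          torusChar (vertexMomTransfer L M κ) (x a))) • vertexMonomial L M κ := by
  unfold vertexFieldWord
  simp only [map_vertexSub_gen]
  rw [sum_smul_mul_four]
  refine Finset.sum_congr rfl fun κ _ => ?_
  congr 1
  rw [← vertexLegPhases_eq]
  push_cast
  ring

omit [NeZero L] in
/-- **The vertex word is the image of the standard paired monomial**: with the pair enumeration
`finProdFinEquiv.symm : Fin (n·2) → Fin n × Fin 2` (position `2a + σ` ↦ (vertex `a`, spin `σ`)),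
`Π_a vertexFieldWord β x τ a = map (toLin' S) (Πᵢ ψ⁺_{P i} ψ⁻_{P i})`. [folklore] -/
theorem prod_vertexFieldWord_eq_map_genPairProd (β : ℝ) {n : ℕ} (x : Fin n → TorusSite 2 L) (τ : Fin n → ℝ) :
    (List.ofFn fun a => vertexFieldWord L M β x τ a).prod =
      ExteriorAlgebra.map (Matrix.toLin' (vertexSubMatrix L M β x τ))
        (genPairProd ℂ (fun i : Fin (n * 2) => (((finProdFinEquiv.symm i : Fin n × Fin 2), 0) : VertexLeg n))
          (fun i : Fin (n * 2) => (((finProdFinEquiv.symm i : Fin n × Fin 2), 1) : VertexLeg n))) := by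
  rw [genPairProd, map_list_prod, List.map_ofFn, prod_ofFn_mul_two]
  congr 1
  refine List.ofFn_inj.2 (funext fun a => ?_)
  simp only [Function.comp_apply, Equiv.symm_apply_apply, map_mul, vertexFieldWord, mul_assoc]

end Position

/-! ### Orthogonality: the space–time integral of the vertex phase is the conservation constraint -/

section Orthogonality

variable {L M : ℕ} [NeZero L]

omit [NeZero L] in
/-- `∫₀^β e^{2πi m τ/β} dτ = β` if `m = 0` and `0` otherwise (`m ∈ ℤ`, `β > 0`). [folklore] -/
theorem integral_Icc_exp_freqTransfer {β : ℝ} (hβ : 0 < β) (m : ℤ) :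
    ∫ t in Set.Icc (0 : ℝ) β, Complex.exp (((2 * Real.pi * m * t / β : ℝ) : ℂ) * Complex.I) =
      if m = 0 then (β : ℂ) else 0 := by
  rw [integral_Icc_eq_integral_Ioc, ← intervalIntegral.integral_of_le hβ.le]
  split_ifs with hm
  · simp [hm]
  · set c : ℂ := 2 * Real.pi * m / β * Complex.I with hc
    have hβ' : (β : ℂ) ≠ 0 := by exact_mod_cast hβ.ne'
    have hm' : (m : ℂ) ≠ 0 := by exact_mod_cast hm
    have hc0 : c ≠ 0 := by
      rw [hc]
      exact mul_ne_zero (div_ne_zero (mul_ne_zero (mul_ne_zero two_ne_zero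
        (by exact_mod_cast Real.pi_ne_zero)) hm') hβ') Complex.I_ne_zero
    have hfun : (fun t : ℝ => Complex.exp (((2 * Real.pi * m * t / β : ℝ) : ℂ) * Complex.I)) =
        fun t : ℝ => Complex.exp (c * t) := by
      funext t
      congr 1
      rw [hc]
      push_cast
      ring
    rw [hfun, integral_exp_mul_complex hc0]
    have h1 : c * (β : ℂ) = m * (2 * Real.pi * Complex.I) := by
      rw [hc]
      field_simp
    rw [h1, Complex.exp_int_mul_two_pi_mul_I, Complex.ofReal_zero, mul_zero, Complex.exp_zero, sub_self, zero_div]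

/-- **Space–time orthogonality for one vertex**:
`Σ_{x⃗} ∫₀^β e^{2πi m(κ)τ/β} χ_{q(κ)}(x⃗) dτ = βL² · [cons κ]`. [cite: BenfattoGiulianiMastropietro2006, §2.1 (2.6a)] -/
theorem sum_integral_vertexLegPhases {β : ℝ} (hβ : 0 < β) (κ : Fin 4 → FreqMomentum L M) :
    ∑ y : TorusSite 2 L, ∫ t in Set.Icc (0 : ℝ) β,
        Complex.exp (((2 * Real.pi * (vertexFreqTransfer L M κ) * t / β : ℝ) : ℂ) * Complex.I) *
          torusChar (vertexMomTransfer L M κ) y =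
      if vertexConserving L M κ then ((β * (L : ℝ) ^ 2 : ℝ) : ℂ) else 0 := by
  simp_rw [integral_mul_const]
  rw [← Finset.mul_sum, sum_torusChar_right, integral_Icc_exp_freqTransfer hβ]
  by_cases hm : vertexFreqTransfer L M κ = 0 <;> by_cases hq : vertexMomTransfer L M κ = 0 <;>
    simp [hm, hq, vertexConserving_iff]

end Orthogonality

/-! ### The moments of the interaction -/

section Moments

variable {L M : ℕ} [NeZero L]

/-- **The moments of the Hubbard interaction are space–time integrals of vertex words** (BGM 2006, (2.6a) versus
(2.6), at every finite frequency cutoff): for every linear functional `φ` on the Grassmann algebra, `β > 0` and `n`,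
`φ(Vⁿ) = Uⁿ Σ_{x⃗ ∈ Λⁿ} ∫_{[0,β]ⁿ} φ(Π_a ψ⁺_{a↑}ψ⁻_{a↑}ψ⁺_{a↓}ψ⁻_{a↓}(x⃗_a,τ_a)) dτ`.  Both sides expand over the leg
momenta `K : Fin n → Fin 4 → (ω,k⃗)`; the space–time integral of the phases factorises over the vertices and each
factor is `βL²` times the conservation constraint. [cite: BenfattoGiulianiMastropietro2006, §2.1 (2.5)-(2.6a)] -/
theorem linearMap_apply_hubbardInteraction_pow {β : ℝ} (hβ : 0 < β) (U : ℝ)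
    (φ : HubbardGrassmann L M →ₗ[ℂ] ℂ) (n : ℕ) :
    φ (hubbardInteraction L M β U ^ n) = (U : ℂ) ^ n * ∑ x : Fin n → TorusSite 2 L,
      ∫ τ in Set.Icc (0 : Fin n → ℝ) (fun _ => β), φ ((List.ofFn fun a => vertexFieldWord L M β x τ a).prod) := by
  have hL : ((L : ℝ) : ℂ) ≠ 0 := by exact_mod_cast NeZero.ne L
  have hβ' : (β : ℂ) ≠ 0 := by exact_mod_cast hβ.ne'
  -- notation: the coefficients and the phase factor of a vertex
  set c₄ : ℂ := (((1 / (β * (L : ℝ) ^ 2)) ^ 4 : ℝ) : ℂ) with hc₄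
  set c₃ : ℂ := (((1 / (β * (L : ℝ) ^ 2)) ^ 3 : ℝ) : ℂ) with hc₃
  set F : (Fin 4 → FreqMomentum L M) → TorusSite 2 L → ℝ → ℂ := fun κ y t =>
    c₄ * (Complex.exp (((2 * Real.pi * (vertexFreqTransfer L M κ) * t / β : ℝ) : ℂ) * Complex.I) *
      torusChar (vertexMomTransfer L M κ) y) with hF
  have hcU : (((U / (β * (L : ℝ) ^ 2) ^ 3 : ℝ) : ℂ)) = (U : ℂ) * c₃ := by
    rw [hc₃]; push_cast; ring
  have hc₃₄ : c₄ * ((β * (L : ℝ) ^ 2 : ℝ) : ℂ) = c₃ := by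
    rw [hc₃, hc₄]; push_cast; field_simp
  -- (i) the position-side expansion of the word
  have hword : ∀ (x : Fin n → TorusSite 2 L) (τ : Fin n → ℝ),
      (List.ofFn fun a => vertexFieldWord L M β x τ a).prod =
        ∑ K : Fin n → Fin 4 → FreqMomentum L M,
          (∏ a, F (K a) (x a) (τ a)) • (List.ofFn fun a => vertexMonomial L M (K a)).prod := by
    intro x τ
    rw [← prod_ofFn_sum_smul (fun a κ => F κ (x a) (τ a)) (fun _ κ => vertexMonomial L M κ)]
    congr 1
    refine congrArg List.ofFn (funext fun a => ?_)
    rw [vertexFieldWord_eq_sum]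
  -- (ii) the momentum-side expansion of `Vⁿ`
  have hpow : hubbardInteraction L M β U ^ n = ∑ K : Fin n → Fin 4 → FreqMomentum L M,
      (∏ a, (if vertexConserving L M (K a) then (U : ℂ) * c₃ else 0)) •
        (List.ofFn fun a => vertexMonomial L M (K a)).prod := by
    rw [← prod_ofFn_sum_smul (fun _ κ => if vertexConserving L M κ then (U : ℂ) * c₃ else 0)
      (fun _ κ => vertexMonomial L M κ), ← hcU, ← hubbardInteraction_eq_sum_smul, List.ofFn_const, List.prod_replicate]
  -- (iii) the single-vertex orthogonality in the coefficient `F`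
  have hone : ∀ κ : Fin 4 → FreqMomentum L M,
      ∑ y : TorusSite 2 L, ∫ t in Set.Icc (0 : ℝ) β, F κ y t = if vertexConserving L M κ then c₃ else 0 := by
    intro κ
    simp only [hF, integral_const_mul]
    rw [← Finset.mul_sum, sum_integral_vertexLegPhases hβ, mul_ite, mul_zero, hc₃₄]
  -- (iv) the space–time integral factorises over the vertices
  have horth : ∀ K : Fin n → Fin 4 → FreqMomentum L M,
      ∑ x : Fin n → TorusSite 2 L, ∫ τ in Set.Icc (0 : Fin n → ℝ) (fun _ => β), ∏ a, F (K a) (x a) (τ a) =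
        ∏ a, (if vertexConserving L M (K a) then c₃ else 0) := by
    intro K
    have hμ : (volume : Measure (Fin n → ℝ)).restrict (Set.Icc 0 fun _ => β) =
        Measure.pi fun _ : Fin n => (volume : Measure ℝ).restrict (Set.Icc 0 β) := by
      rw [volume_pi, ← Set.pi_univ_Icc, Measure.restrict_pi_pi]
      rfl
    have hcube : ∀ x : Fin n → TorusSite 2 L,
        ∫ τ in Set.Icc (0 : Fin n → ℝ) (fun _ => β), ∏ a, F (K a) (x a) (τ a) =
          ∏ a, ∫ t in Set.Icc (0 : ℝ) β, F (K a) (x a) t := by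
      intro x
      rw [hμ]
      exact integral_fintype_prod_eq_prod (fun a t => F (K a) (x a) t)
    simp_rw [hcube]
    rw [← Fintype.prod_sum (fun a y => ∫ t in Set.Icc (0 : ℝ) β, F (K a) y t)]
    exact Finset.prod_congr rfl fun a _ => hone (K a)
  -- (v) integrability of each term of the expanded integrand (continuity on the compact cube)
  have hint : ∀ (x : Fin n → TorusSite 2 L) (K : Fin n → Fin 4 → FreqMomentum L M) (r : ℂ),
      Integrable (fun τ : Fin n → ℝ => (∏ a, F (K a) (x a) (τ a)) * r)
        ((volume : Measure (Fin n → ℝ)).restrict (Set.Icc 0 fun _ => β)) := by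
    intro x K r
    have hcont : Continuous fun τ : Fin n → ℝ => (∏ a, F (K a) (x a) (τ a)) * r := by
      refine Continuous.mul (continuous_finsetProd _ fun a _ => ?_) continuous_const
      simp only [hF]
      refine continuous_const.mul (Continuous.mul ?_ continuous_const)
      refine Complex.continuous_exp.comp (Continuous.mul (Complex.continuous_ofReal.comp ?_) continuous_const)
      exact ((continuous_const.mul (continuous_apply a)).div_const _)
    exact hcont.continuousOn.integrableOn_compact isCompact_Icc
  -- (vi) the right-hand side, term by term
  have hR : ∀ x : Fin n → TorusSite 2 L,
      ∫ τ in Set.Icc (0 : Fin n → ℝ) (fun _ => β), φ ((List.ofFn fun a => vertexFieldWord L M β x τ a).prod) =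
        ∑ K : Fin n → Fin 4 → FreqMomentum L M,
          (∫ τ in Set.Icc (0 : Fin n → ℝ) (fun _ => β), ∏ a, F (K a) (x a) (τ a)) *
            φ ((List.ofFn fun a => vertexMonomial L M (K a)).prod) := by
    intro x
    simp_rw [hword, map_sum, map_smul, smul_eq_mul]
    rw [integral_finsetSum _ (fun K _ => hint x K _)]
    exact Finset.sum_congr rfl fun K _ => integral_mul_const _ _
  simp_rw [hR]
  rw [Finset.sum_comm]
  simp_rw [← Finset.sum_mul, horth]
  rw [hpow, map_sum, Finset.mul_sum]
  refine Finset.sum_congr rfl fun K _ => ?_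
  rw [map_smul, smul_eq_mul, Fintype.prod_ite_zero, Fintype.prod_ite_zero]
  simp only [Finset.prod_const, Finset.card_univ, Fintype.card_fin, mul_pow]
  split_ifs <;> ring

/-- The same for Gaussian expectations: `∫dμ_C Vⁿ = Uⁿ Σ_{x⃗} ∫_{[0,β]ⁿ} ∫dμ_C Π_a vertexFieldWord β x τ a dτ`.
[cite: BenfattoGiulianiMastropietro2006, §2.1 (2.6)] -/
theorem gaussExpect_hubbardInteraction_pow {β : ℝ} (hβ : 0 < β) (U : ℝ)
    (C : Matrix (HubbardFieldIdx L M) (HubbardFieldIdx L M) ℂ) (n : ℕ) :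
    gaussExpect ℂ C (hubbardInteraction L M β U ^ n) = (U : ℂ) ^ n * ∑ x : Fin n → TorusSite 2 L,
      ∫ τ in Set.Icc (0 : Fin n → ℝ) (fun _ => β),
        gaussExpect ℂ C ((List.ofFn fun a => vertexFieldWord L M β x τ a).prod) :=
  linearMap_apply_hubbardInteraction_pow hβ U (gaussExpect ℂ C) n

/-- **The moments of the interaction under the zero-seed free covariance are integrated Wick determinants**
(BGM 2006, (2.6)–(2.8) at frequency cutoff `M`):
`∫dμ_{C_M} Vⁿ = Uⁿ Σ_{x⃗} ∫_{[0,β]ⁿ} det[−(SᵀC_MS)((P i,+),(P j,−))]_{i,j} dτ`, `P = finProdFinEquiv.symm` the standard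
enumeration of the `2n` (vertex, spin) pairs. [cite: BenfattoGiulianiMastropietro2006, §2.1 (2.6)-(2.8)] -/
theorem gaussExpect_hubbardInteraction_pow_eq_det {β : ℝ} (hβ : 0 < β) (μ U : ℝ) (n : ℕ) :
    gaussExpect ℂ (hubbardCovariance L M β μ 0) (hubbardInteraction L M β U ^ n) =
      (U : ℂ) ^ n * ∑ x : Fin n → TorusSite 2 L, ∫ τ in Set.Icc (0 : Fin n → ℝ) (fun _ => β),
        (Matrix.of fun i j : Fin (n * 2) => -((vertexSubMatrix L M β x τ).transpose * hubbardCovariance L M β μ 0 *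
          vertexSubMatrix L M β x τ) ((((finProdFinEquiv.symm i : Fin n × Fin 2)), 0) : VertexLeg n)
            ((((finProdFinEquiv.symm j : Fin n × Fin 2)), 1) : VertexLeg n)).det := by
  rw [gaussExpect_hubbardInteraction_pow hβ]
  refine congrArg _ (Finset.sum_congr rfl fun x _ => integral_congr_ae (Eventually.of_forall fun τ => ?_))
  simp only
  rw [prod_vertexFieldWord_eq_map_genPairProd, gaussExpect_vertexPairWord_eq_det]

/-- **The `M → ∞` limit of the moments**: for `β > 0` and fixed `(L, μ, U, n)`,
`∫dμ_{C_M} Vⁿ → Uⁿ Σ_{x⃗} ∫_{[0,β]ⁿ} det[vertexLimitEntry(x⃗_{aᵢ}, x⃗_{aⱼ}, σᵢ, σⱼ; τ_{aⱼ} − τ_{aᵢ})]_{i,j} dτ`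
(free imaginary-time propagators with the midpoint at equal times; `HubbardVertexCoefficientLimit`).
[cite: BenfattoGiulianiMastropietro2006, §2.1 (2.6)-(2.8)] -/
theorem tendsto_gaussExpect_hubbardInteraction_pow {β : ℝ} (hβ : 0 < β) (μ U : ℝ) (n : ℕ) :
    Tendsto (fun M : ℕ => gaussExpect ℂ (hubbardCovariance L M β μ 0) (hubbardInteraction L M β U ^ n)) atTop
      (𝓝 ((U : ℂ) ^ n * ∑ x : Fin n → TorusSite 2 L, ∫ τ in Set.Icc (0 : Fin n → ℝ) (fun _ => β),
        (Matrix.of fun i j : Fin (n * 2) =>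
          vertexLimitEntry L β μ (x (finProdFinEquiv.symm i : Fin n × Fin 2).1)
            (x (finProdFinEquiv.symm j : Fin n × Fin 2).1) (finProdFinEquiv.symm i : Fin n × Fin 2).2
            (finProdFinEquiv.symm j : Fin n × Fin 2).2
            (τ (finProdFinEquiv.symm j : Fin n × Fin 2).1 - τ (finProdFinEquiv.symm i : Fin n × Fin 2).1)).det)) := by
  simp_rw [gaussExpect_hubbardInteraction_pow_eq_det hβ]
  exact (tendsto_finsetSum _ fun x _ =>
    tendsto_integral_cube_det_vertexWick hβ μ x (fun i : Fin (n * 2) => (finProdFinEquiv.symm i : Fin n × Fin 2))).const_mul _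

end Moments

end Literature.MathematicalPhysics.QuantumLattice
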